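import Summits.RiemannHypothesis.RiemannHypothesis.Theorems.Splittings.ScrewKreinCoreDefs
import Literature.Analysis.OperatorTheory.KreinStewartAbstract
import Literature.Analysis.OperatorTheory.KreinStewartTranslationForm
import HarnessLib

/-!
# Screw index transfer, discrete Kreĭn core (1/3): finite-dimensional inertia and point-mass bookkeeping

rh-split-screw-bridge g6 (pub cell `rh-split`), lane (xii-d), file 1 of 3 (cut of `xiid/ScrewKreinDiscreteCore.lean`
4a64dcf011b356fc, §1–§3).  Towards `indexBounded_imp_foz` / T2 `etail_iff_foz` WITHOUT the Kreĭn–Stewart fact (file 3/3):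

* §1 `exists_comb_re_energy_nonneg`: a Hermitian matrix with `≤ κ` negative eigenvalues has, among any `κ + 1` vectors, a
  non-trivial combination of non-negative energy; `pointMassH_of_negIndexLE`: hence the hypothesis `H` of the tree's
  `KreinStewart.negSqLE_BF` for a kernel all of whose point-mass matrices have `≤ κ` negative eigenvalues.
* §2 `negSqLE_BF_fC` (with the landed node reduction `negIndexLE_of_indexBounded`, p505922): `IndexBounded ⟹` the
  translation form `BF fC`, `fC = −zetaScrew`, has `≤ K + 1` negative squares; `exists_definitizer`: the tree's elementary
  `KreinStewart.abs_definitization` then gives `P ≠ 0`, `deg P ≤ K + 1`, with `BF fC (P(SDOp η) v, P(SDOp η) v) ≥ 0`.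
* §3 translations `U a` commute with `P(SDOp η)`; `aeval_single_support`: `P(SDOp η) δ₀` is supported on
  `{mη : −deg P ≤ m ≤ deg P}` with top coefficient `leadingCoeff P · (2iη)^{−deg P} ≠ 0`.

Classification tags: [folklore] = standard analysis/algebra; [new-combination] = assembled here.
HONEST LABEL: SPLITTING SEARCH over kernel-typed RH-EQUIVALENCES; `etail_iff_foz` relates two OPEN tail statements and
decides neither; nothing here bears on the truth of RH.
-/

noncomputable section

set_option linter.dupNamespace false

namespace Summit.RiemannHypothesis.RiemannHypothesis.Theorems.Splittings.ScrewKreinDiscrete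

open Finset Complex MeasureTheory Set Filter Topology Polynomial Module
open scoped ComplexConjugate Matrix
open Literature.NumberTheory.LFunctions
open Literature.Analysis.OperatorTheory
open Literature.Analysis.OperatorTheory.KreinStewart
open Summit.RiemannHypothesis.RiemannHypothesis.Theses.RuelleBand
open Summit.RiemannHypothesis.RiemannHypothesis.Theorems.IntegerScrew
open Summit.RiemannHypothesis.RiemannHypothesis.Theorems.Splittings.ScrewKreinCore
open Summit.RiemannHypothesis.RiemannHypothesis.Theorems.Splittings.ScrewIndexTransferKrein

/-! ## §1 Finite-dimensional inertia: `≤ κ` negative eigenvalues ⟹ no negative-definite `(κ+1)`-span -/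

/-- Mathlib's orthonormal eigenvector basis of a Hermitian matrix is `star`-dot-orthonormal. [folklore] -/
theorem eigenvectorBasis_star_dotProduct {n : ℕ} {M : Matrix (Fin n) (Fin n) ℂ} (hM : M.IsHermitian)
    (i j : Fin n) :
    star (hM.eigenvectorBasis i).ofLp ⬝ᵥ (hM.eigenvectorBasis j).ofLp = if i = j then 1 else 0 := by
  have h := (orthonormal_iff_ite.mp hM.eigenvectorBasis.orthonormal) i j
  rw [EuclideanSpace.inner_eq_star_dotProduct, dotProduct_comm] at h
  exact h

/-- The energy of a combination of eigenvectors with non-negative eigenvalues is non-negative. [folklore] -/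
theorem re_energy_nonneg_of_mem_span {n : ℕ} {M : Matrix (Fin n) (Fin n) ℂ} (hM : M.IsHermitian)
    {y : Fin n → ℂ}
    (hy : y ∈ Submodule.span ℂ
      (Set.range fun i : {i : Fin n // 0 ≤ hM.eigenvalues i} => (hM.eigenvectorBasis i.1).ofLp)) :
    0 ≤ (star y ⬝ᵥ M *ᵥ y).re := by
  classical
  obtain ⟨a, rfl⟩ := (Submodule.mem_span_range_iff_exists_fun ℂ).mp hy
  set e : {i : Fin n // 0 ≤ hM.eigenvalues i} → (Fin n → ℂ) := fun i => (hM.eigenvectorBasis i.1).ofLp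
    with he
  have hMe : ∀ i : {i : Fin n // 0 ≤ hM.eigenvalues i},
      M *ᵥ e i = ((hM.eigenvalues i.1 : ℝ) : ℂ) • e i := by
    intro i
    rw [he]
    simp only
    rw [hM.mulVec_eigenvectorBasis i.1, Complex.coe_smul]
  have horth : ∀ i j : {i : Fin n // 0 ≤ hM.eigenvalues i}, star (e i) ⬝ᵥ e j = if i = j then 1 else 0 := by
    intro i j
    rw [he]
    simp only
    rw [eigenvectorBasis_star_dotProduct hM i.1 j.1]
    by_cases hij : i = j
    · rw [if_pos hij, if_pos (congrArg Subtype.val hij)]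
    · rw [if_neg hij, if_neg (fun h => hij (Subtype.ext h))]
  have h1 : M *ᵥ (∑ i, a i • e i) = ∑ i, (a i * (hM.eigenvalues i.1 : ℂ)) • e i := by
    rw [← Matrix.mulVecLin_apply, map_sum]
    refine Finset.sum_congr rfl fun i _ => ?_
    rw [map_smul, Matrix.mulVecLin_apply, hMe i, smul_smul]
  have h2 : star (∑ i, a i • e i) ⬝ᵥ (∑ j, (a j * (hM.eigenvalues j.1 : ℂ)) • e j)
      = ∑ i, star (a i) * (a i * (hM.eigenvalues i.1 : ℂ)) := by
    rw [star_sum, sum_dotProduct]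
    refine Finset.sum_congr rfl fun i _ => ?_
    rw [star_smul, dotProduct_sum, Finset.sum_eq_single i (fun j _ hji => ?_)
      (fun hi => absurd (Finset.mem_univ i) hi)]
    · rw [smul_dotProduct, dotProduct_smul, horth i i, if_pos rfl, smul_eq_mul, smul_eq_mul, mul_one]
    · rw [smul_dotProduct, dotProduct_smul, horth i j, if_neg (Ne.symm hji), smul_zero, smul_zero]
  rw [h1, h2, Complex.re_sum]
  refine Finset.sum_nonneg fun i _ => ?_
  rw [← mul_assoc, Complex.star_def, ← Complex.normSq_eq_conj_mul_self, ← Complex.ofReal_mul,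
    Complex.ofReal_re]
  exact mul_nonneg (Complex.normSq_nonneg _) i.2

/-- **Inertia lemma.** A Hermitian matrix with at most `κ` negative eigenvalues: among any `κ + 1` vectors some
non-trivial linear combination has non-negative energy. [folklore] -/
theorem exists_comb_re_energy_nonneg {n : ℕ} {M : Matrix (Fin n) (Fin n) ℂ} (hM : M.IsHermitian) (κ : ℕ)
    (hκ : (univ.filter fun i => hM.eigenvalues i < 0).card ≤ κ) (u : Fin (κ + 1) → (Fin n → ℂ)) :
    ∃ c : Fin (κ + 1) → ℂ, c ≠ 0 ∧ 0 ≤ (star (∑ i, c i • u i) ⬝ᵥ M *ᵥ (∑ i, c i • u i)).re := by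
  classical
  by_cases hli : LinearIndependent ℂ u
  · set e : {i : Fin n // 0 ≤ hM.eigenvalues i} → (Fin n → ℂ) := fun i => (hM.eigenvectorBasis i.1).ofLp
      with he
    set N : Submodule ℂ (Fin n → ℂ) := Submodule.span ℂ (Set.range e) with hN
    set W : Submodule ℂ (Fin n → ℂ) := Submodule.span ℂ (Set.range u) with hW
    -- dimensions
    have hWd : finrank ℂ W = κ + 1 := by rw [hW, finrank_span_eq_card hli, Fintype.card_fin]
    have heli : LinearIndependent ℂ e := by
      have h0 : LinearIndependent ℂ fun i : Fin n => (hM.eigenvectorBasis i).ofLp := by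
        rw [Fintype.linearIndependent_iff]
        intro g hg i
        have h := congrArg (fun v => star (hM.eigenvectorBasis i).ofLp ⬝ᵥ v) hg
        simp only [dotProduct_sum, dotProduct_smul, smul_eq_mul, dotProduct_zero] at h
        rw [Finset.sum_eq_single i (fun j _ hji => by
          rw [eigenvectorBasis_star_dotProduct hM i j, if_neg (Ne.symm hji), mul_zero])
          (fun hi => absurd (Finset.mem_univ i) hi), eigenvectorBasis_star_dotProduct hM i i,
          if_pos rfl, mul_one] at h
        exact h
      exact h0.comp _ Subtype.val_injective
    have hNd : finrank ℂ N = Fintype.card {i : Fin n // 0 ≤ hM.eigenvalues i} := by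
      rw [hN, finrank_span_eq_card heli]
    have hcard : (univ.filter fun i => hM.eigenvalues i < 0).card +
        Fintype.card {i : Fin n // 0 ≤ hM.eigenvalues i} = n := by
      have h := Finset.card_filter_add_card_filter_not (s := (univ : Finset (Fin n)))
        (fun i => hM.eigenvalues i < 0)
      rw [Finset.card_univ, Fintype.card_fin] at h
      rw [Fintype.card_subtype]
      convert h using 3
      exact Finset.filter_congr fun i _ => by rw [not_lt]
    have hsup : finrank ℂ ↥(W ⊔ N) ≤ n := by
      calc finrank ℂ ↥(W ⊔ N) ≤ finrank ℂ (Fin n → ℂ) := Submodule.finrank_le _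
        _ = n := by rw [Module.finrank_pi, Fintype.card_fin]
    have hdim := Submodule.finrank_sup_add_finrank_inf_eq W N
    have hinf : 0 < finrank ℂ ↥(W ⊓ N) := by omega
    have hne : W ⊓ N ≠ ⊥ := fun h => by
      rw [← Submodule.finrank_eq_zero] at h
      omega
    obtain ⟨y, hy, hy0⟩ := Submodule.exists_mem_ne_zero_of_ne_bot hne
    obtain ⟨c, hc⟩ := (Submodule.mem_span_range_iff_exists_fun ℂ).mp (Submodule.mem_inf.mp hy).1
    refine ⟨c, fun h0 => hy0 ?_, ?_⟩
    · rw [← hc, h0]; simp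
    · rw [hc]
      exact re_energy_nonneg_of_mem_span hM (Submodule.mem_inf.mp hy).2
  · obtain ⟨c, hc0, i, hi⟩ := Fintype.not_linearIndependent_iff.mp hli
    refine ⟨c, fun h => hi (by rw [h]; rfl), ?_⟩
    rw [hc0]; simp

/-- The inertia lemma in the coordinates of the hypothesis `H` of `KreinStewart.negSqLE_BF` /
`kreinDefinitization_main`. [folklore] -/
theorem pointMassH_of_negIndexLE (F : ℝ → ℂ) (hF : ∀ x, F (-x) = conj (F x)) (κ : ℕ)
    (hle : ∀ (r : ℕ) (x : Fin r → ℝ),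
      (univ.filter fun i => (kreinKernelMatrix_isHermitian F hF r x).eigenvalues i < 0).card ≤ κ)
    (n : ℕ) (x : Fin n → ℝ) (v : Fin (κ + 1) → Fin n → ℂ) :
    ∃ w : Fin (κ + 1) → ℂ, w ≠ 0 ∧
      0 ≤ (∑ k, ∑ l, (∑ i, w i * v i k) * conj (∑ i, w i * v i l) * F (x k - x l)).re := by
  classical
  obtain ⟨c, hc0, hc⟩ := exists_comb_re_energy_nonneg (kreinKernelMatrix_isHermitian F hF n x) κ (hle n x)
    (fun i k => conj (v i k))
  refine ⟨fun i => conj (c i), ?_, ?_⟩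
  · intro h
    apply hc0
    funext i
    have hi : conj (c i) = 0 := by simpa using congrFun h i
    simpa using hi
  · convert hc using 2
    -- both sides are the same double sum
    simp only [dotProduct, Matrix.mulVec, Matrix.of_apply]
    refine Finset.sum_congr rfl fun k _ => ?_
    rw [Finset.mul_sum]
    refine Finset.sum_congr rfl fun l _ => ?_
    simp only [Pi.star_apply, Finset.sum_apply, Pi.smul_apply, smul_eq_mul, star_sum, star_mul',
      Complex.star_def, Complex.conj_conj, map_sum, map_mul]
    ring

/-! ## §2 `IndexBounded ⟹` Kreĭn's hypothesis for the point-mass form `BF fC`; the definitizing polynomial -/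

/-- `f = −Ψ` is Hermitian (indeed real and even). -/
theorem fC_symm : ∀ x : ℝ, fC (-x) = conj (fC x) := fun x => by
  simp only [fC, zetaScrew_neg, Complex.conj_ofReal]

/-- **IndexBounded ⟹ `BF fC` has at most `K + 1` negative squares** (landed node reduction
`negIndexLE_of_indexBounded` + the inertia lemma + `KreinStewart.negSqLE_BF`). [new-combination] -/
theorem negSqLE_BF_fC (K : ℕ)
    (hK : ∀ n : ℕ, (univ.filter fun i => (screwMatrix_isHermitian n).eigenvalues i < 0).card ≤ K) :
    NegSqLE (BF fC) (K + 1) :=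
  negSqLE_BF fC (K + 1)
    (pointMassH_of_negIndexLE fC negScrewC_symm (K + 1) (negIndexLE_of_indexBounded K hK))

/-- **The definitizing polynomial** for the difference operator `SDOp η` (tree: `KreinStewart.abs_definitization`,
the elementary replacement of Pontryagin's theorem — NO named fact). [new-combination] -/
theorem exists_definitizer (K : ℕ)
    (hK : ∀ n : ℕ, (univ.filter fun i => (screwMatrix_isHermitian n).eigenvalues i < 0).card ≤ K) (η : ℝ) :
    ∃ P : ℂ[X], P ≠ 0 ∧ P.natDegree ≤ K + 1 ∧
      ∀ v : ℝ →₀ ℂ, 0 ≤ (BF fC (aeval (SDOp η) P v) (aeval (SDOp η) P v)).re :=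
  abs_definitization (isSymm_BF fC_symm) (isSymOp_SDOp fC η) (negSqLE_BF_fC K hK)

/-! ## §3 Point-mass bookkeeping: translations, the difference operator, lattice support of `P(SDOp η) δ₀` -/

/-- Evaluation of a translate: `(U a x)(t) = x(t − a)`. [folklore] -/
theorem U_apply_pt (a : ℝ) (x : ℝ →₀ ℂ) (t : ℝ) : U a x t = x (t - a) := by
  have h := Finsupp.mapDomain_apply (add_left_injective a) x (t - a)
  rw [sub_add_cancel] at h
  exact h

/-- Composition of translations. [folklore] -/
theorem U_U (a b : ℝ) (x : ℝ →₀ ℂ) : U a (U b x) = U (a + b) x := by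
  rw [U, U, U, Finsupp.lmapDomain_apply, Finsupp.lmapDomain_apply, Finsupp.lmapDomain_apply,
    ← Finsupp.mapDomain_comp]
  congr 1
  funext s
  simp only [Function.comp_apply]
  ring

/-- `U 0 = id`. [folklore] -/
theorem U_zero (x : ℝ →₀ ℂ) : U 0 x = x := by
  rw [U, Finsupp.lmapDomain_apply]
  have : (fun s : ℝ => s + 0) = id := funext fun s => by simp
  rw [this, Finsupp.mapDomain_id]

/-- Translations commute with the difference operator. [folklore] -/
theorem commute_U_SDOp (a η : ℝ) : Commute (U a : Module.End ℂ (ℝ →₀ ℂ)) (SDOp η) := by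
  refine LinearMap.ext fun x => ?_
  change U a (SDOp η x) = SDOp η (U a x)
  rw [SDOp_apply, SDOp_apply, map_smul, map_sub, U_U, U_U, U_U, U_U, add_comm a η, add_comm a (-η)]

/-- Translations commute with `P(SDOp η)`. [folklore] -/
theorem commute_U_aeval (a η : ℝ) (P : ℂ[X]) :
    Commute (U a : Module.End ℂ (ℝ →₀ ℂ)) (aeval (SDOp η : Module.End ℂ (ℝ →₀ ℂ)) P) := by
  rw [aeval_eq_sum_range]
  refine Commute.sum_right _ _ _ fun j _ => ?_
  exact ((commute_U_SDOp a η).pow_right j).smul_right _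

/-- Evaluation of `SDOp η x` at a point. [folklore] -/
theorem SDOp_apply_pt (η : ℝ) (x : ℝ →₀ ℂ) (t : ℝ) :
    SDOp η x t = ((2 : ℂ) * Complex.I * η)⁻¹ * (x (t - η) - x (t + η)) := by
  rw [SDOp_apply, Finsupp.smul_apply, Finsupp.sub_apply, U_apply_pt, U_apply_pt, sub_neg_eq_add,
    smul_eq_mul]

/-- Support of `(SDOp η)^j δ₀` lies in `{mη : m ∈ ℤ, |m| ≤ j}`, and its value at `jη` is `(2iη)^{−j}`. [folklore] -/
theorem SDOp_pow_single (η : ℝ) (hη : η ≠ 0) (j : ℕ) :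
    (∀ t ∈ ((SDOp η ^ j) (Finsupp.single 0 1) : ℝ →₀ ℂ).support,
        ∃ m : ℤ, t = m * η ∧ -(j : ℤ) ≤ m ∧ m ≤ j) ∧
      ((SDOp η ^ j) (Finsupp.single 0 1) : ℝ →₀ ℂ) ((j : ℝ) * η) = (((2 : ℂ) * Complex.I * η)⁻¹) ^ j := by
  induction j with
  | zero =>
    refine ⟨fun t ht => ⟨0, ?_, le_rfl, le_rfl⟩, ?_⟩
    · rw [pow_zero, Module.End.one_apply] at ht
      have := Finsupp.support_single_subset ht
      rw [Finset.mem_singleton] at this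
      simp [this]
    · simp
  | succ j ih =>
    obtain ⟨ihs, ihv⟩ := ih
    -- values vanish at lattice points beyond `j`
    have hvan : ∀ m : ℤ, (j : ℤ) < m → ((SDOp η ^ j) (Finsupp.single 0 1) : ℝ →₀ ℂ) ((m : ℝ) * η) = 0 := by
      intro m hm
      by_contra h
      obtain ⟨m', hm', -, hle⟩ := ihs _ (Finsupp.mem_support_iff.mpr h)
      have : (m : ℝ) = m' := by
        have := mul_right_cancel₀ hη hm'
        exact_mod_cast this
      have : m = m' := by exact_mod_cast this
      omega
    refine ⟨fun t ht => ?_, ?_⟩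
    · rw [pow_succ', Module.End.mul_apply] at ht
      have hval := Finsupp.mem_support_iff.mp ht
      rw [SDOp_apply_pt] at hval
      by_cases h1 : ((SDOp η ^ j) (Finsupp.single 0 1) : ℝ →₀ ℂ) (t - η) = 0
      · by_cases h2 : ((SDOp η ^ j) (Finsupp.single 0 1) : ℝ →₀ ℂ) (t + η) = 0
        · exact absurd (by rw [h1, h2, sub_zero, mul_zero]) hval
        · obtain ⟨m, hm, hlo, hhi⟩ := ihs _ (Finsupp.mem_support_iff.mpr h2)
          refine ⟨m - 1, ?_, by omega, by omega⟩
          push_cast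
          linarith
      · obtain ⟨m, hm, hlo, hhi⟩ := ihs _ (Finsupp.mem_support_iff.mpr h1)
        refine ⟨m + 1, ?_, by omega, by omega⟩
        push_cast
        linarith
    · rw [pow_succ', Module.End.mul_apply, SDOp_apply_pt]
      have e1 : ((j + 1 : ℕ) : ℝ) * η - η = (j : ℝ) * η := by push_cast; ring
      have e2 : ((j + 1 : ℕ) : ℝ) * η + η = (((j : ℤ) + 2 : ℤ) : ℝ) * η := by push_cast; ring
      rw [e1, e2, ihv, hvan _ (by omega), sub_zero, pow_succ, mul_comm]

/-- The vector `ψ = P(SDOp η) δ₀`: lattice support in `[−d, d]·η` and non-vanishing top value `ψ(dη) = p_d (2iη)^{−d}`,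
`d = natDegree P`. [folklore] -/
theorem aeval_single_support (η : ℝ) (hη : η ≠ 0) (P : ℂ[X]) :
    (∀ t ∈ (aeval (SDOp η : Module.End ℂ (ℝ →₀ ℂ)) P (Finsupp.single 0 1)).support,
        ∃ m : ℤ, t = m * η ∧ -(P.natDegree : ℤ) ≤ m ∧ m ≤ P.natDegree) ∧
      (aeval (SDOp η : Module.End ℂ (ℝ →₀ ℂ)) P (Finsupp.single 0 1)) ((P.natDegree : ℝ) * η)
        = P.leadingCoeff * (((2 : ℂ) * Complex.I * η)⁻¹) ^ P.natDegree := by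
  classical
  set d := P.natDegree with hd
  have hexp : aeval (SDOp η : Module.End ℂ (ℝ →₀ ℂ)) P (Finsupp.single 0 1)
      = ∑ j ∈ Finset.range (d + 1), P.coeff j • (SDOp η ^ j) (Finsupp.single 0 1) := by
    rw [aeval_eq_sum_range, LinearMap.sum_apply]
    refine Finset.sum_congr rfl fun j _ => ?_
    rw [LinearMap.smul_apply]
  refine ⟨fun t ht => ?_, ?_⟩
  · rw [hexp] at ht
    obtain ⟨j, hj, hjt⟩ := Finset.mem_biUnion.mp (Finsupp.support_finsetSum ht)
    obtain ⟨m, hm, hlo, hhi⟩ := (SDOp_pow_single η hη j).1 t (Finsupp.support_smul hjt)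
    have hj' : j ≤ d := by
      have := Finset.mem_range.mp hj
      omega
    exact ⟨m, hm, by omega, by omega⟩
  · rw [hexp, Finsupp.finsetSum_apply, Finset.sum_eq_single_of_mem d (Finset.mem_range.mpr (by omega))]
    · rw [Finsupp.smul_apply, smul_eq_mul, (SDOp_pow_single η hη d).2, Polynomial.leadingCoeff, ← hd]
    · intro j hj hjd
      have hjd' : j < d := lt_of_le_of_ne (by have := Finset.mem_range.mp hj; omega) hjd
      rw [Finsupp.smul_apply, smul_eq_mul]
      -- the value of `(SDOp η)^j δ₀` at `dη` vanishes for `j < d`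
      have hz : ((SDOp η ^ j) (Finsupp.single 0 1) : ℝ →₀ ℂ) ((d : ℝ) * η) = 0 := by
        by_contra h
        obtain ⟨m', hm', -, hle⟩ := (SDOp_pow_single η hη j).1 _ (Finsupp.mem_support_iff.mpr h)
        have h1 : ((d : ℤ) : ℝ) = m' := by
          have := mul_right_cancel₀ hη hm'
          exact_mod_cast this
        have h2 : (d : ℤ) = m' := by exact_mod_cast h1
        omega
      rw [hz, mul_zero]

end Summit.RiemannHypothesis.RiemannHypothesis.Theorems.Splittings.ScrewKreinDiscrete
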